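import Literature.NumberTheory.EllipticCurves.Castella2024.LambdaAdicHeegnerClass
import Literature.NumberTheory.EllipticCurves.BurungaleKobayashiNakamuraOta2026.LocalBottomIndex
import HarnessLib

/-!
# Existence of the `Λ`-adic Heegner class of `p`-power conductor (Bertolini–Darmon 1996, §2.4–2.5,
# eq. (7) and Prop. 2.7; Castella 2024, §2.2 (2.2)): norm-compatible ("coherent") Heegner families
# and the PROVED non-vacuity of `IsLambdaAdicHeegnerClass`

Cross-ladder LITERATURE-TYPING layer (D-0088(4)), cell `bsd-littype`, seat `bsd-littype-05` (re-seat
g3); OPEN-QUESTIONS-05 Q11 (b), FAITHFULNESS-05 §6c. `Castella2024.IsLambdaAdicHeegnerClass D F α z`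
(p463498), the regularized `Λ`-adic Heegner class of `p`-power conductor in `𝔖_p = lim←_n S_p(E/K_n)`,
is what the tree's Heegner point main conjecture binders at `p ∣ N` quantify over
(`KellerYin2024.thm521_multHg_…_OPEN`, `Castella2024.thm13_…_OPEN`: `∀ z, IsLambdaAdicHeegnerClass D F α z
→ …`). Its EXISTENCE was not recorded: a `HeegnerFamily` fixes each norm point `F.z n` only up to a
`Gal(K_n/K)`-translate, and for an incoherent `F` no such `z` exists (the binders are then vacuous
for that `F`). This file
* DEFINES the coherence predicate `HeegnerFamily.IsNormCompatible F γ α`: the two-term norm relation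
  `Tr_{K_{n+1}/K_n}(z_{n+1}) = α · z_n` of Bertolini–Darmon at `p ∣ N`, written with the transversal
  `{γ^{p^n i}}_{i<p}` of `Gal(K̄/K_{n+1})` in `Gal(K̄/K_n)` used by `LambdaAdicSelmerData.proj_norm`;
* PROVES `Castella2024.exists_isLambdaAdicHeegnerClass` (and `existsUnique_…`): for `α² = 1` and a
  coherent family there is `z ∈ 𝔖_p` with `IsLambdaAdicHeegnerClass D F α z` — Bertolini–Darmon's
  Prop. 2.7 followed by Castella's sentence at (2.2), in the kernel. NO named fact (net debt 0).
The Kummer-theoretic plumbing — conjugation / restriction of Kummer classes, Kummer ⇒ Selmer, Kummer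
families are compact Selmer and behave well under `σ •`, `res`, `ℤ`-multiples, sums — is PROVED here
(`WeierstrassCurve` namespace) over the Literature API of `BurungaleKobayashiNakamuraOta2026/
LocalBottomIndex.lean`; two Summits-side K7r files (`…BottomLocalIndexSplitKummer`,
`…KummerFamiliesSelmer`) prove the first three for their own use (not importable here, D-0017).

## The sources, verbatim (held text `[corpus: paper:doi-10-1007-s002220050105]`, PDF pages)

* Bertolini–Darmon, Invent. Math. 126 (1996), **§2.4** (p. 432 = p0020:L37–L52): "A compatible system
  of points: Let `σ` be a generator of `Gal(K_n/K_{n-1})`, and write `Norm_{K_n/K_{n-1}} = Σ σ^i` …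
  if `p ∣ N` …, one defines a map `H_N(K; cp^n) → H_N(K; cp^{n-1})`, by letting `P̄` be the unique
  point such that `Norm_{K_n/K_{n-1}}(P) = U_p(P̄)`. Choose points `P_n ∈ H_N(K; cp^n)` which are
  compatible under these maps"; (p. 433 = p0021:L25–L26): "If `p` divides `N` …, then
  `Norm_{K_{n+1}/K_n}(P_{n+1}) = U_p P_n`, if `n ≥ 1`"; **§2.5** (p. 435 = p0023:L5–L12), Case 2 (`p`
  divides `N`): "**(7)** `Norm_{K_{n+1}/K_n}(y_{n+1}) = a_p y_n` if `n ≥ 1` … Let `α = a_p` be the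
  unit root of `x² − a_p x`. Note that `α = ±1` in this case. `z_n = (1/αⁿ) y_n` if `n ≥ 1`";
  **Prop. 2.7** (p0023:L44–L47): "In all cases, the points `z_n ∈ Z_p` are norm-compatible, i.e.,
  `Σ_{σ ∈ G_{n+1,n}} z_{n+1}^σ = z_n`." (`K_n` = ring class field of conductor `c pⁿ`, `y_n ∈ E(K_n)`.)
* Castella, arXiv:2409.01360 (UNREFEREED), §2.2 (2.2) `[corpus: paper:arxiv-2409.01360 p0005:L19–L60]`:
  "the points `z_m` are norm-compatible. Thus taking their images under the Kummer map … we obtain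
  the compatible family of cohomology classes `𝐳_∞ := {z_m}_m ∈ lim←_m Sel(H_{p^m}, T)` … in `𝔖_p`".

## Transcription

* The tree's family carries `F.z n = Norm_{K[p^{n+1}]/K_n} P[p^{n+1}] ∈ E(K_n)`, `K_n` the
  anticyclotomic layer (`HeegnerModuleIndex.lean`; genuine norms under the vocabulary's standing
  `p ∤ h_K`). For compatibly chosen points, (7) at Bertolini–Darmon's index `n + 1 ≥ 1` gives
  `Norm_{K_{n+1}/K_n}(F.z (n+1)) = Norm_{K[p^{n+1}]/K_n}(a_p y_{n+1}) = a_p · F.z n` for EVERY `n ≥ 0`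
  (relation (8) at conductor `1` never enters: the family starts at conductor `p`) — this is
  `F.IsNormCompatible γ α`, `α = a_p`, with `Norm_{K_{n+1}/K_n} = Σ_{i<p} γ^{p^n i}` on the
  transversal of `LambdaAdicSelmerData.proj_norm` (so no fact about `γ` is needed).
* Proof of existence: `x_n := α^{n+1} · δ_{K_n}(F.z n)` (Kummer family) is compact Selmer, and
  `res_{K_{n+1}}(x_n)`, `Σ_{i<p} conj_{γ^{p^n i}}(x_{n+1})` are the Kummer families over `K_{n+1}` of
  `α^{n+1} F.z n` and of `Σ_i γ^{p^n i} (α^{n+2} F.z (n+1)) = α^{n+3} F.z n = α^{n+1} F.z n` — equal;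
  `LambdaAdicSelmerData.surj` then yields `z` (defining property by root independence).

## Contents

Parts 1–3 (`WeierstrassCurve.`, all PROVED): `conjH1_kummerClassOver`, `resOfLe_kummerClassOver`,
`torsionToPointsH1_kummerClassOver`, `localResTorsionOverOfEmb_kummerClassOver`,
`kummerClassOver_mem_selmerTorsionOver` (Kummer ⇒ Selmer), `IsKummerFamilyOver.mem_compactSelmerOver`,
`IsKummerFamilyOver.{of_eq, conjPi, resPi, neg, zsmul, sum}`. Part 4: `HeegnerFamily.IsNormCompatible`
(DEFINITION, + unfolding `sum_smul_z_eq`), `Castella2024.exists_isLambdaAdicHeegnerClass`,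
`Castella2024.existsUnique_isLambdaAdicHeegnerClass` (PROVED).

## References

* [BertoliniDarmon1996] M. Bertolini, H. Darmon, *Heegner points on Mumford–Tate curves*, Invent.
  Math. 126 (1996) 413–456: §2.4 (p. 432–433), §2.5 eq. (7)–(8) and Prop. 2.7 (p. 435).
* [Castella2024] F. Castella, arXiv:2409.01360 (2024), UNREFEREED: §2.2 eq. (2.2).
* [Howard2004HeegnerKolyvagin] B. Howard, Compositio Math. 140 (2004), §1, §3.3 (Kummer maps `δ_k`).
* [PerrinRiou1987BSMF] B. Perrin-Riou, Bull. SMF 115 (1987), §0 (p. 401–402: `S_p(L)`, `𝔖_p`), §3.4.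
* [SilvermanAEC2009] J. Silverman, *AEC*, VIII.§2 (Kummer sequence), X.§4 (Thm. 4.2).
-/

set_option autoImplicit false

noncomputable section

open scoped Classical

open Literature.NumberTheory.EllipticCurves Literature.NumberTheory.GaloisRepresentations

universe u

/-! ## Part 1. Kummer classes under conjugation and restriction (any field) -/

namespace WeierstrassCurve

section KummerGalois

variable {F : Type u} [Field F] (V : WeierstrassCurve F)

/-- **Conjugation of a Kummer class is the Kummer class of the conjugated root**:
`conj_σ δ(m•Q) = δ(m•σQ)` in `H¹(H, E[m])` for `H` normal (on cocycles
`σ•((σ⁻¹τσ)Q − Q) = τ(σQ) − σQ`; Literature-side twin of a Summits-side lemma of the K7r cell).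
[cite: SilvermanAEC2009, VIII.§2 (the Kummer cocycle)] -/
theorem conjH1_kummerClassOver (H : Subgroup (Field.absoluteGaloisGroup F)) [H.Normal] (m : ℤ)
    (σ : Field.absoluteGaloisGroup F) (Q : geomPoints V) (hQ : ∀ τ ∈ H, τ • (m • Q) = m • Q) :
    Literature.NumberTheory.EllipticCurves.conjH1 H (geomTorsion V m) σ (V.kummerClassOver H m Q hQ) =
      V.kummerClassOver H m (σ • Q) (fun τ hτ ↦ by
        rw [← smul_zsmul_geomPoints, ← mul_smul,
          show τ * σ = σ * (σ⁻¹ * τ * σ) by group, mul_smul,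
          hQ _ (conj_mem_of_normal H σ ⟨τ, hτ⟩), smul_zsmul_geomPoints]) := by
  rw [Literature.NumberTheory.EllipticCurves.conjH1, kummerClassOver, kummerClassOver]
  refine (map_oneCocycleClass (X := discreteTopRep H (geomTorsion V m))
    (Y := discreteTopRep H (geomTorsion V m)) (subgroupConj H σ) (resHomOfEquivariant _ _ _)
    (V.kummerCocycleOver H m Q hQ)).trans ?_
  congr 1
  refine Subtype.ext (ContinuousMap.ext fun τ ↦ Subtype.ext ?_)
  change σ • ((σ⁻¹ * (τ : Field.absoluteGaloisGroup F) * σ) • Q - Q) =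
    (τ : Field.absoluteGaloisGroup F) • σ • Q - σ • Q
  rw [smul_sub, ← mul_smul, show σ * (σ⁻¹ * (τ : Field.absoluteGaloisGroup F) * σ) = τ * σ by group,
    mul_smul]

/-- **Restriction of a Kummer class is the Kummer class over the smaller group**:
`res_{H'→H} δ_{L'}(m•Q) = δ_L(m•Q)` for `H ≤ H'` (same cocycle `τ ↦ τQ − Q`, restricted).
[cite: SilvermanAEC2009, VIII.§2 (the Kummer cocycle)] -/
theorem resOfLe_kummerClassOver {H H' : Subgroup (Field.absoluteGaloisGroup F)} (h : H ≤ H') (m : ℤ)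
    (Q : geomPoints V) (hQ : ∀ τ ∈ H', τ • (m • Q) = m • Q) :
    Literature.NumberTheory.EllipticCurves.resOfLe (geomTorsion V m) h (V.kummerClassOver H' m Q hQ) =
      V.kummerClassOver H m Q (fun τ hτ ↦ hQ τ (h hτ)) := by
  rw [Literature.NumberTheory.EllipticCurves.resOfLe, kummerClassOver, kummerClassOver]
  refine (map_oneCocycleClass (X := discreteTopRep H' (geomTorsion V m))
    (Y := discreteTopRep H (geomTorsion V m)) (subgroupInclusion h) (resHomOfEquivariant _ _ _)
    (V.kummerCocycleOver H' m Q hQ)).trans ?_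
  congr 1

end KummerGalois

/-! ## Part 2. Kummer ⇒ Selmer; Kummer families are compact Selmer (number fields) -/

section LocalKummer

variable {K : Type u} [Field K] (W : WeierstrassCurve K)
variable {E : Type u} [Field E] [Algebra K E] (ι : AlgebraicClosure K →ₐ[K] AlgebraicClosure E)

/-- **A Kummer class of the local curve dies in `H¹(H', E(K̄_E))`**: the image of
`δ(m • Q) = [σ ↦ σQ − Q]` under the coefficient map `E[m] ⊆ E(K̄_E)` (`torsionToPointsH1`) is the
coboundary of `Q` (Kummer sequence). RESTATES (Literature-side, Summits not importable) the tree's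
`Summit.BirchSwinnertonDyer.….RamifiedSevenEllipticUnits.LocalIndexSplitReading.torsionToPointsH1_kummerClassOver`.
[cite: SilvermanAEC2009, VIII.§2 (the Kummer sequence, Prop. 2.1 setting)] -/
theorem torsionToPointsH1_kummerClassOver (m : ℤ) (H' : Subgroup (Field.absoluteGaloisGroup E))
    (Q : geomPoints (W.baseChange E)) (hQ : ∀ σ ∈ H', σ • (m • Q) = m • Q) :
    W.torsionToPointsH1 m H' ((W.baseChange E).kummerClassOver H' m Q hQ) = 0 := by
  rw [WeierstrassCurve.torsionToPointsH1, WeierstrassCurve.kummerClassOver]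
  refine (map_oneCocycleClass (X := discreteTopRep H' (geomTorsion (W.baseChange E) m))
    (Y := discreteTopRep H' (localPoints W E)) (ContinuousMonoidHom.id H') (resHomOfEquivariant _ _ _)
    ((W.baseChange E).kummerCocycleOver H' m Q hQ)).trans ?_
  rw [oneCocycleClass_eq_zero_iff]
  refine ⟨W.geomPointsToLocalPoints (E := E) Q, fun σ ↦ ?_⟩
  change W.geomPointsToLocalPoints ((((W.baseChange E).kummerCocycleOver H' m Q hQ).1 σ :
      geomTorsion (W.baseChange E) m) : geomPoints (W.baseChange E)) =
    (σ : Field.absoluteGaloisGroup E) • W.geomPointsToLocalPoints (E := E) Q -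
      W.geomPointsToLocalPoints (E := E) Q
  rw [coe_kummerCocycleOver_apply, map_sub, Subgroup.smul_def, geomPointsToLocalPoints_smul]

/-- **The local restriction (points coefficients) of a global Kummer class vanishes** at the place
singled out by `ι` (`localResTorsionOverOfEmb = torsionToPointsH1 ∘ localTorsionResOfEmb`).
[cite: SilvermanAEC2009, X.§4 (Remark 4.1.1: the local image of the Kummer map)] -/
theorem localResTorsionOverOfEmb_kummerClassOver (m : ℤ) (H : Subgroup (Field.absoluteGaloisGroup K))
    (Q : geomPoints W) (hQ : ∀ τ ∈ H, τ • (m • Q) = m • Q) :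
    W.localResTorsionOverOfEmb m H ι (W.kummerClassOver H m Q hQ) = 0 := by
  rw [localResTorsionOverOfEmb_eq_comp, AddMonoidHom.comp_apply, localTorsionResOfEmb_kummerClassOver,
    torsionToPointsH1_kummerClassOver]

end LocalKummer

section Selmer

variable {K : Type u} [Field K] [NumberField K] (V : WeierstrassCurve K)

/-- **Kummer classes are Selmer classes**: `δ(m•Q) ∈ Sel^{(m)}(E/L)` for `m•Q ∈ E(L)`, `L = K̄^H`
(conjugate by `σ` = pass to the root `σQ`; the local restriction vanishes). RESTATES the tree's
`Summit.BirchSwinnertonDyer.….RamifiedSevenEllipticUnits.BottomLocalIndexSplit.kummerClassOver_mem_selmerTorsionOver`.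
[cite: SilvermanAEC2009, X.§4 (Thm. 4.2: `E(K)/mE(K) ↪ Sel^{(m)}(E/K)`)] [cite: PerrinRiou1987BSMF, §0 p. 401] -/
theorem kummerClassOver_mem_selmerTorsionOver (H : Subgroup (Field.absoluteGaloisGroup K)) [H.Normal]
    (m : ℤ) (Q : geomPoints V) (hQ : ∀ τ ∈ H, τ • (m • Q) = m • Q) :
    V.kummerClassOver H m Q hQ ∈ V.selmerTorsionOver H m := by
  simp only [selmerTorsionOver, AddSubgroup.mem_inf, AddSubgroup.mem_iInf, AddSubgroup.mem_comap,
    AddMonoidHom.mem_ker]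
  exact ⟨fun v σ ↦ by rw [conjH1_kummerClassOver, localResTorsionOverOfEmb_kummerClassOver],
    fun w σ ↦ by rw [conjH1_kummerClassOver, localResTorsionOverOfEmb_kummerClassOver]⟩

variable (p : ℕ) [Fact p.Prime] (H : Subgroup (Field.absoluteGaloisGroup K)) [H.Normal]

variable {V p H} in
/-- **Kummer families are compact Selmer elements**: the Kummer family `(δ_L(P))_k` of an `H`-fixed
point lies in `S_p(E/L) = lim←_k Sel^{(p^k)}(E/L)` (Selmer at every level; `p_*`-compatible) — the
compact Kummer map `E(L) ⊗ ℤ_p → S_p(E/L)`. [cite: Howard2004HeegnerKolyvagin, §1 (descent sequence `0 → E(L) ⊗ ℤ_p → S_p(E/L) → …`)] -/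
theorem IsKummerFamilyOver.mem_compactSelmerOver [V.IsElliptic] {P : geomPoints V}
    {hP : ∀ σ ∈ H, σ • P = P} {d : V.torsionH1Pi p H} (hd : V.IsKummerFamilyOver p H hP d) :
    d ∈ V.compactSelmerOver H p := by
  rw [mem_compactSelmerOver_iff]
  refine ⟨fun k ↦ ?_, fun k ↦ IsKummerFamilyOver.reduceTorsionH1 p hd k⟩
  have hpk : ((p : ℤ) ^ k) ≠ 0 := pow_ne_zero _ (Int.natCast_ne_zero.mpr (Fact.out : p.Prime).ne_zero)
  obtain ⟨Q, hQ⟩ := V.zsmul_geomPoints_surjective_holds hpk P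
  rw [hd k Q hQ]
  exact kummerClassOver_mem_selmerTorsionOver V H _ Q _

end Selmer

/-! ## Part 3. Kummer families under conjugation, restriction, integer multiples and sums (any field) -/

section KummerFamilyOps

variable {F : Type u} [Field F] {V : WeierstrassCurve F} {p : ℕ} [Fact p.Prime]
  {H : Subgroup (Field.absoluteGaloisGroup F)}

omit [Fact p.Prime] in
/-- Transport of `IsKummerFamilyOver` along an equality of points. [cite: Howard2004HeegnerKolyvagin, §1 (the compact Kummer map)] -/
theorem IsKummerFamilyOver.of_eq {P P' : geomPoints V} (h : P = P') {hP : ∀ σ ∈ H, σ • P = P}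
    {hP' : ∀ σ ∈ H, σ • P' = P'} {d : V.torsionH1Pi p H} (hd : V.IsKummerFamilyOver p H hP d) :
    V.IsKummerFamilyOver p H hP' d := h ▸ hd

/-- **Conjugation maps the Kummer family of `P` to the Kummer family of `σ • P`** (`H` normal;
levelwise `conjH1_kummerClassOver`, roots `σQ` of `σP`). [cite: Howard2004HeegnerKolyvagin, §1 (the compact Kummer map is `Gal(L/K)`-equivariant)] -/
theorem IsKummerFamilyOver.conjPi [H.Normal] [V.IsElliptic] (σ : Field.absoluteGaloisGroup F)
    {P : geomPoints V} {hP : ∀ τ ∈ H, τ • P = P} {d : V.torsionH1Pi p H}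
    (hd : V.IsKummerFamilyOver p H hP d) :
    V.IsKummerFamilyOver p H (P := σ • P) (fun τ hτ ↦ by
      rw [← mul_smul, show τ * σ = σ * (σ⁻¹ * τ * σ) by group, mul_smul,
        hP _ (conj_mem_of_normal H σ ⟨τ, hτ⟩)]) (V.conjPi p H σ d) := by
  intro k Q' hQ'
  have hpk : ((p : ℤ) ^ k) ≠ 0 := pow_ne_zero _ (Int.natCast_ne_zero.mpr (Fact.out : p.Prime).ne_zero)
  obtain ⟨Q, (hQ : ((p : ℤ) ^ k) • Q = P)⟩ := V.zsmul_geomPoints_surjective_holds hpk P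
  have hσQ : ((p : ℤ) ^ k) • (σ • Q) = σ • P := by rw [← smul_zsmul_geomPoints, hQ]
  simp only [WeierstrassCurve.conjPi, AddMonoidHom.pi_apply, AddMonoidHom.coe_comp,
    Function.comp_apply, Pi.evalAddMonoidHom_apply]
  rw [hd k Q hQ, conjH1_kummerClassOver]
  exact V.kummerClassOver_eq_of_zsmul_eq H _ _ _ _ _ (hσQ.trans hQ'.symm)

omit [Fact p.Prime] in
/-- **Restriction maps the Kummer family of `P` over `L' = F̄^{H'}` to its Kummer family over
`L = F̄^{H} ⊇ L'`** (`H ≤ H'`; levelwise `resOfLe_kummerClassOver`). [cite: PerrinRiou1987BSMF, §0 pp. 401–402 (the restriction maps `S_p(K_n) → S_p(K_{n+1})`)] -/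
theorem IsKummerFamilyOver.resPi {H' : Subgroup (Field.absoluteGaloisGroup F)}
    (h : H ≤ H') {P : geomPoints V} {hP : ∀ τ ∈ H', τ • P = P} {d : V.torsionH1Pi p H'}
    (hd : V.IsKummerFamilyOver p H' hP d) :
    V.IsKummerFamilyOver p H (fun τ hτ ↦ hP τ (h hτ)) (V.resPi p h d) := by
  intro k Q hQ
  simp only [WeierstrassCurve.resPi, AddMonoidHom.pi_apply, AddMonoidHom.coe_comp,
    Function.comp_apply, Pi.evalAddMonoidHom_apply]
  rw [hd k Q hQ, resOfLe_kummerClassOver]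

omit [Fact p.Prime] in
/-- **The Kummer family of `-P` is `-d`** (from additivity and `δ(0) = 0`). [cite: SilvermanAEC2009, VIII.§2 (the Kummer pairing is bilinear)] -/
theorem IsKummerFamilyOver.neg [V.IsElliptic] {P : geomPoints V} {hP : ∀ τ ∈ H, τ • P = P}
    {d : V.torsionH1Pi p H} (hd : V.IsKummerFamilyOver p H hP d) :
    V.IsKummerFamilyOver p H (P := -P) (fun τ hτ ↦ by rw [smul_neg, hP τ hτ]) (-d) := by
  intro k Q hQ -- `-Q` is a root of `P`, and `δ(Q) + δ(-Q) = δ(Q + (-Q)) = 0` (a root of `0`)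
  have hnegQ : ((p : ℤ) ^ k) • (-Q) = P := by rw [smul_neg, hQ, neg_neg]
  have hfixQ : ∀ τ ∈ H, τ • (((p : ℤ) ^ k) • Q) = ((p : ℤ) ^ k) • Q := by simpa [hQ] using hP
  have hfixnQ : ∀ τ ∈ H, τ • (((p : ℤ) ^ k) • (-Q)) = ((p : ℤ) ^ k) • (-Q) := by simpa [hnegQ] using hP
  have h0 : ((p : ℤ) ^ k) • (Q + -Q) = (0 : geomPoints V) := by rw [add_neg_cancel, smul_zero]
  have hzero : V.kummerClassOver H _ Q hfixQ + V.kummerClassOver H _ (-Q) hfixnQ = 0 := by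
    rw [← V.kummerClassOver_add H _ Q (-Q) hfixQ hfixnQ]
    exact ((isKummerFamilyOver_zero (V := V) (H' := H) (p := p)) k (Q + -Q) h0).symm
  rw [Pi.neg_apply, hd k (-Q) hnegQ]
  exact neg_eq_of_add_eq_zero_left hzero

/-- **The Kummer family of `a • P` is `a • d`** (`a : ℤ`; additivity). [cite: SilvermanAEC2009, VIII.§2 (the Kummer pairing is bilinear)] -/
theorem IsKummerFamilyOver.zsmul [V.IsElliptic] {P : geomPoints V} {hP : ∀ τ ∈ H, τ • P = P}
    {d : V.torsionH1Pi p H} (hd : V.IsKummerFamilyOver p H hP d) (a : ℤ) :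
    V.IsKummerFamilyOver p H (P := a • P) (fun τ hτ ↦ by rw [smul_zsmul_geomPoints, hP τ hτ])
      (a • d) := by
  induction a using Int.induction_on with
  | zero => simpa only [zero_smul] using (isKummerFamilyOver_zero (V := V) (H' := H) (p := p))
  | succ i ih =>
    have := IsKummerFamilyOver.add p ih hd
    simpa only [add_smul, one_smul] using this
  | pred i ih =>
    have := IsKummerFamilyOver.add p ih (IsKummerFamilyOver.neg hd)
    simpa only [add_smul, neg_smul, one_smul, sub_eq_add_neg] using this

/-- **The Kummer family of a finite sum of points is the sum of the Kummer families.**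
[cite: SilvermanAEC2009, VIII.§2 (the Kummer pairing is bilinear)] -/
theorem IsKummerFamilyOver.sum [V.IsElliptic] {ι : Type*} (s : Finset ι) {P : ι → geomPoints V}
    {hP : ∀ i, ∀ τ ∈ H, τ • P i = P i} {d : ι → V.torsionH1Pi p H}
    (hd : ∀ i, V.IsKummerFamilyOver p H (hP i) (d i)) :
    V.IsKummerFamilyOver p H (P := ∑ i ∈ s, P i)
      (fun τ hτ ↦ by rw [Finset.smul_sum]; exact Finset.sum_congr rfl fun i _ ↦ hP i τ hτ)
      (∑ i ∈ s, d i) := by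
  induction s using Finset.induction_on with
  | empty =>
    simpa only [Finset.sum_empty] using (isKummerFamilyOver_zero (V := V) (H' := H) (p := p))
  | insert i s hi ih =>
    have := IsKummerFamilyOver.add p (hd i) ih
    simpa only [Finset.sum_insert hi] using this

end KummerFamilyOps

end WeierstrassCurve

/-! ## Part 4. Coherent Heegner families and the existence of the `Λ`-adic Heegner class -/

namespace Literature.NumberTheory.EllipticCurves

open _root_.WeierstrassCurve

namespace HeegnerFamily

variable {K : Type u} [Field K] [NumberField K] {N : ℕ} [NeZero N] {W : WeierstrassCurve ℚ}
  {p : ℕ} [Fact p.Prime] {κ : ZpExtension K p} {jbar : AlgebraicClosure K →+* ℂ}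

/-- **Norm-compatibility ("coherence") of a Heegner family with sign `α`** (Bertolini–Darmon 1996,
§2.4 "A compatible system of points … Choose points `P_n ∈ H_N(K; cp^n)` which are compatible under
these maps" and, for `p ∣ N`, "`Norm_{K_{n+1}/K_n}(P_{n+1}) = U_p P_n` if `n ≥ 1`", whence §2.5 (7)
"`Norm_{K_{n+1}/K_n}(y_{n+1}) = a_p y_n` if `n ≥ 1` … `α = a_p` … `α = ±1` in this case"): the norm
points of `F` satisfy the TWO-TERM norm relation `Tr_{K_{n+1}/K_n}(z_{n+1}) = α · z_n` along the
anticyclotomic layers for every `n`, the trace being summed over the transversal `{γ^{p^n i}}_{i<p}`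
of `Gal(K̄/K_{n+1})` in `Gal(K̄/K_n)` (`γ` a topological generator; the transversal of the tree's
`LambdaAdicSelmerData.proj_norm`). In the tree's indexation `F.z n` has conductor `p^{n+1}`, so this
is (7) at Bertolini–Darmon's index `n + 1 ≥ 1` transported to the layers (`K_n ⊆ K[p^{n+1}]`, the
vocabulary's standing `p ∤ h_K`). A `HeegnerFamily` fixes each `F.z n` only up to a
`Gal(K_n/K)`-translate; the predicate singles out the compatibly chosen ("coherent") families, which
carry a `Λ`-adic class (`Castella2024.exists_isLambdaAdicHeegnerClass`). (At `p ∤ N` the printed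
relation is the THREE-term (5), not this one.)
[cite: BertoliniDarmon1996, §2.4 (p. 432–433) and §2.5 eq. (7) (p. 435)] -/
def IsNormCompatible (F : HeegnerFamily N W K κ jbar) (γ : Field.absoluteGaloisGroup K) (α : ℤ) :
    Prop :=
  ∀ n : ℕ, ∑ i ∈ Finset.range p, (γ ^ (p ^ n * i)) • F.z (n + 1) = α • F.z n

/-- Unfolding of `IsNormCompatible` at a layer. [cite: BertoliniDarmon1996, §2.5 eq. (7)] -/
theorem IsNormCompatible.sum_smul_z_eq {F : HeegnerFamily N W K κ jbar} {γ : Field.absoluteGaloisGroup K}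
    {α : ℤ} (h : F.IsNormCompatible γ α) (n : ℕ) :
    ∑ i ∈ Finset.range p, (γ ^ (p ^ n * i)) • F.z (n + 1) = α • F.z n := h n

end HeegnerFamily

namespace Castella2024

variable {K : Type u} [Field K] [NumberField K] {N : ℕ} [NeZero N] {W : WeierstrassCurve ℚ}
  {p : ℕ} [Fact p.Prime] {κ : ZpExtension K p} {γ : Field.absoluteGaloisGroup K}
  {jbar : AlgebraicClosure K →+* ℂ}

/-- **Existence of the `Λ`-adic Heegner class of a coherent family** (Bertolini–Darmon 1996,
Prop. 2.7: "In all cases, the points `z_n ∈ Z_p` are norm-compatible, i.e.,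
`Σ_{σ ∈ G_{n+1,n}} z_{n+1}^σ = z_n`"; Castella 2024, (2.2): "taking their images under the Kummer
map … we obtain the compatible family of cohomology classes `𝐳_∞ … ∈ lim←_m Sel(H_{p^m}, T)` … its
natural image in `𝔖_p`"). For an elliptic `E/ℚ`, a `Λ`-adic Selmer datum `D` (`𝔖_p = lim←_n S_p(E/K_n)`),
a sign `α` with `α² = 1` (`α = a_p = ±1` at a multiplicative prime) and a Heegner family `F` that is
norm-compatible with sign `α` (`HeegnerFamily.IsNormCompatible`), there is `z ∈ 𝔖_p` whose
`(n, k)`-component is `α^{n+1} · δ_{K_n}(F.z n)` for every `p^k`-th root, i.e.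
`IsLambdaAdicHeegnerClass D F α z` (proof in the module docstring: Kummer families, `proj_norm` via
uniqueness of Kummer families, `LambdaAdicSelmerData.surj`, root independence; no hypothesis on `γ`).
[cite: BertoliniDarmon1996, §2.5 Prop. 2.7 (p. 435)] [cite: Howard2004HeegnerKolyvagin, §3.3 and §1] -/
theorem exists_isLambdaAdicHeegnerClass [W.IsElliptic] (D : (W.baseChange K).LambdaAdicSelmerData κ γ)
    (F : HeegnerFamily N W K κ jbar) {α : ℤ} (hα : α ^ 2 = 1) (hF : F.IsNormCompatible γ α) :
    ∃ z : D.S, IsLambdaAdicHeegnerClass D F α z := by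
  -- Kummer families `d n` of the norm points `F.z n`; `x n = α^{n+1} • d n` is compact Selmer and
  -- `proj_norm`-compatible (both sides of `hnorm` are Kummer families of the same point over `K_{n+1}`)
  have hfix : ∀ n, ∀ σ ∈ κ.layerSubgroup n, σ • F.z n = F.z n := fun n σ hσ ↦
    (F.isHeegnerNormPoint_z n).smul_eq_self hσ
  choose d hd using fun n ↦
    (W.baseChange K).exists_isKummerFamilyOver p (κ.layerSubgroup n) (F.z n) (hfix n)
  have hsel : ∀ n, (α ^ (n + 1)) • d n ∈ (W.baseChange K).compactSelmerOver (κ.layerSubgroup n) p :=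
    fun n ↦ AddSubgroup.zsmul_mem _ (WeierstrassCurve.IsKummerFamilyOver.mem_compactSelmerOver (hd n)) _
  have hnorm : ∀ n, (W.baseChange K).resPi p (κ.layerSubgroup_antitone (Nat.le_succ n))
      ((α ^ (n + 1)) • d n) =
      ∑ i ∈ Finset.range p, (W.baseChange K).conjPi p (κ.layerSubgroup (n + 1)) (γ ^ (p ^ n * i))
        ((α ^ (n + 1 + 1)) • d (n + 1)) := by
    intro n
    have hL := WeierstrassCurve.IsKummerFamilyOver.resPi (κ.layerSubgroup_antitone (Nat.le_succ n))
      (WeierstrassCurve.IsKummerFamilyOver.zsmul (hd n) (α ^ (n + 1)))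
    have hR := WeierstrassCurve.IsKummerFamilyOver.sum (Finset.range p) fun i ↦
      WeierstrassCurve.IsKummerFamilyOver.conjPi (γ ^ (p ^ n * i))
        (WeierstrassCurve.IsKummerFamilyOver.zsmul (hd (n + 1)) (α ^ (n + 1 + 1)))
    have hαα : α ^ (n + 1 + 1) * α = α ^ (n + 1) := by rw [pow_succ, mul_assoc, ← sq, hα, mul_one]
    have hpt : ∑ i ∈ Finset.range p, (γ ^ (p ^ n * i)) • ((α ^ (n + 1 + 1)) • F.z (n + 1)) =
        (α ^ (n + 1)) • F.z n :=
      calc ∑ i ∈ Finset.range p, (γ ^ (p ^ n * i)) • ((α ^ (n + 1 + 1)) • F.z (n + 1))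
          = ∑ i ∈ Finset.range p, (α ^ (n + 1 + 1)) • ((γ ^ (p ^ n * i)) • F.z (n + 1)) :=
            Finset.sum_congr rfl fun i _ ↦ by rw [smul_zsmul_geomPoints]
        _ = (α ^ (n + 1 + 1)) • ∑ i ∈ Finset.range p, (γ ^ (p ^ n * i)) • F.z (n + 1) :=
            (Finset.smul_sum (M := ℤ) (N := geomPoints (W.baseChange K))).symm
        _ = (α ^ (n + 1 + 1)) • (α • F.z n) := by rw [hF n]
        _ = (α ^ (n + 1 + 1) * α) • F.z n := smul_smul _ _ _
        _ = (α ^ (n + 1)) • F.z n := by rw [hαα]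
    exact WeierstrassCurve.IsKummerFamilyOver.unique p hL
      (WeierstrassCurve.IsKummerFamilyOver.of_eq hpt hR)
  obtain ⟨s, hs⟩ := D.surj (fun n ↦ (α ^ (n + 1)) • d n) hsel hnorm
  refine ⟨s, fun n k Q hQ ↦ ?_⟩
  rw [hs n, Pi.smul_apply, hd n k Q hQ]

/-- **Unique existence of the `Λ`-adic Heegner class of a coherent family** (with
`IsLambdaAdicHeegnerClass.unique`): Castella's "the compatible family `𝐳_∞`". [cite: BertoliniDarmon1996, §2.5 Prop. 2.7 (p. 435)] -/
theorem existsUnique_isLambdaAdicHeegnerClass [W.IsElliptic]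
    (D : (W.baseChange K).LambdaAdicSelmerData κ γ) (F : HeegnerFamily N W K κ jbar) {α : ℤ}
    (hα : α ^ 2 = 1) (hF : F.IsNormCompatible γ α) :
    ∃! z : D.S, IsLambdaAdicHeegnerClass D F α z :=
  (exists_isLambdaAdicHeegnerClass D F hα hF).elim fun z hz ↦ ⟨z, hz, fun _ hz' ↦ hz'.unique hz⟩

end Castella2024

end Literature.NumberTheory.EllipticCurves

end
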